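import Summits.CriticalPhenomena.PercolationContinuityZ3.Theorems.Transplant.FKDoubleFanTwoSidedConeS
import HarnessLib

/-!
# Double fans `K₂ ∨ P_{m+1}`: the TWO-SIDED dominance cones are NOT letter-stable — `HypAS q`, `HypBS q`, `HypA q`, `HypB q` are FALSE
# for every `0 < q < 1`

Helper file (`--supports stmt-CriticalPhenomena-4575`), FK sub-lane `prim-bschramm-fk-3` (gen 42); builds on p205010 (kernel theorem, internal
audit signed; external expert review pending).  No named facts, no sorries; standard axioms.  Memo `bschramm/prim-bschramm-fk-3/FAR-CROSS-XVII.md`.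

NEGATIVE RESULT closing the two-sided dominance programme of gens 36–41 (`…OneSidedDominance` `HypA ∧ HypB`, `…TwoSidedConeS` `HypAS ∧ HypBS`,
`…TwoSidedConeSCross(A)`, `…TwoSidedSignsB(Cert*)`): those reductions are correct but their common hypothesis is false, for every `q ∈ (0,1)` —
exactly as `…OneSidedConeSRefuted` (gen 40) closed the one-sided programme.

* The separating bivector **`sepBiv2 q`** `= ⟨−1, 1, 0, 0, 2−q, 1, 1−q, −1, 0, 0⟩`, i.e. (`pairH_sepBiv2`) the hat–Plücker functional
  `Φ_q(β) = (1−q)²·[(2−q)(β_uy − β_ux − β_xy) + β_xv + β_yz − β_xz]` — gen 40's `γ_q = e_uy + (1−q)e_xv − e_yz` corrected by `−e_ux + (2−q)e_xy + e_xz`.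
* **`pairH_imgA_sepBiv2`** (identity, all `q, F, w`):
  `Φ_q(imgA q F w) = (1−q)²·( N^{(bc)}(w)·[F₀² + F₀F_ab + F₀F_ac + F_abF_ac + (2−q)(F₀F_bc + F_abF_bc)] + N^{(ac)}(F)·[(2−q)(w_ab w_bc + Λ(w)) + N^{(ab)}(w)] )`,
  hence `≥ 0` for `F, w ∈ Valid q`, `0 ≤ q ≤ 1` (**`pairH_imgA_sepBiv2_nonneg`**).
* **`pairH_imgB_sepBiv2`** (identity, all `q, G, w`): `Φ_q(imgB q G w) = (1−q)²·Σ` of 29 products (non-negative `q`-factor) × (valid form of `G`)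
  × (valid form of `w`), hence `≥ 0` for `G, w ∈ Valid q`, `0 ≤ q ≤ 1` (**`pairH_imgB_sepBiv2_nonneg`**).  So **`sepBiv2_tsDualS`**: `sepBiv2 q ∈ TSDualS q`
  and **`sepBiv2_osDual`**: `sepBiv2 q ∈ OSDual q`.
* WITNESS (honest double-fan word "rest `BC_{1/10}`, pin `a c_j`, rim step `E_{1/2}`, then BOTH spokes `A_{9/10} B_{7/10}` at the new vertex"):
  `b`-gadget `G₀ = BC_{7/10} ∗ E_{1/2} fanInit = (3/20, 0, 3/20, 7/20, 7/20)` (**`witG`**), `a`-gadget `F₀ = BC_{9/10} ∗ E_{1/2} fanInit = (1/20,0,1/20,9/20,9/20)`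
  (**`witF2`**), rest `w₀ = BC_{1/10} = (9/10, 0, 0, 1/10, 0)` (**`witW2`**), all in `InKE q`;
  `Φ_q(∧²AC_{9/10}·imgB q G₀ w₀) = Φ_q(∧²BC_{7/10}·imgA q F₀ w₀) = (1−q)²·(−159/200000 + 1809q/2000000 − 729q²/4000000) < 0` for `q < 1`
  (**`pairH_witnessA2`**, **`pairH_witnessB2`**, **`witness2_poly_neg`**).
* Hence **`not_hypAS`**, **`not_hypBS`** (…TwoSidedConeS, over `InS`) and **`not_hypA`**, **`not_hypB`** (…OneSidedDominance, over `InKE`) for all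
  `0 < q < 1`: the image of the input pair of `BC_{1/10}` under "rim step, then both spokes" lies OUTSIDE the closed cone generated by ALL single-fan
  (`a`-fan and `b`-fan) images — the cone `K_true` of all word images has generators of alternation depth ≥ 2 at every `q < 1`.
Found by the guarded membership oracle + gen 40's two-sided product-form LP (kit j286226/j286238: the LP separator is `∝ Φ_q` at every `q`;
j286385: exact certificates at `q = 2/5, 4/5`; the `q`-parametric identities were read off the `q = 2/5` certificate and verified symbolically).
[folklore]
-/

noncomputable section

namespace Summit.CriticalPhenomena.PercolationContinuityZ3.Theorems

namespace FK

namespace ThreeApex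

/-! ### The separating functional -/

/-- The two-sided separating bivector `⟨−1, 1, 0, 0, 2−q, 1, 1−q, −1, 0, 0⟩` (coordinates `ux,uy,uz,uv,xy,xz,xv,yz,yv,zv`). [folklore] -/
def sepBiv2 (q : ℝ) : Biv := ⟨-1, 1, 0, 0, 2 - q, 1, 1 - q, -1, 0, 0⟩

/-- `⟪β, sepBiv2 q⟫ = (1−q)²·[(2−q)(β_uy − β_ux − β_xy) + β_xv + β_yz − β_xz]`. [folklore] -/
theorem pairH_sepBiv2 (q : ℝ) (β : Biv) :
    pairH q β (sepBiv2 q) = (1 - q) ^ 2 * ((2 - q) * (β.uy - β.ux - β.xy) + β.xv + β.yz - β.xz) := by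
  simp only [pairH, sepBiv2]; ring

/-! ### Identity and sign on the `a`-images -/

/-- **KEY IDENTITY A.**  On `a`-images the functional is
`(1−q)²·( N^{(bc)}(w)·[F₀² + F₀F_ab + F₀F_ac + F_abF_ac + (2−q)(F₀F_bc + F_abF_bc)] + N^{(ac)}(F)·[(2−q)(w_ab w_bc + Λ(w)) + N^{(ab)}(w)] )`. [folklore] -/
theorem pairH_imgA_sepBiv2 (q : ℝ) (F w : V5) :
    pairH q (imgA q F w) (sepBiv2 q) =
      (1 - q) ^ 2 * (masterN q (swapAB w) * (F.z0 ^ 2 + F.z0 * F.zab + F.z0 * F.zac + F.zab * F.zac + (2 - q) * (F.z0 * F.zbc + F.zab * F.zbc))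
        + masterN q F * ((2 - q) * (w.zab * w.zbc + lam w) + masterN q (swapBC w))) := by
  simp only [pairH, sepBiv2, imgA, fanCombo, wedgeH, conv, edgeAC, detach, hx, hy, hz, V5.total, masterN, lam, swapAB, swapBC]
  ring

/-- **`sepBiv2 q` is non-negative on every `a`-image with valid legs** (`0 ≤ q ≤ 1`). [folklore] -/
theorem pairH_imgA_sepBiv2_nonneg {q : ℝ} (_hq0 : 0 ≤ q) (hq1 : q ≤ 1) {F w : V5} (hF : Valid q F) (hw : Valid q w) :
    0 ≤ pairH q (imgA q F w) (sepBiv2 q) := by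
  obtain ⟨⟨hF0, hFab, hFac, hFbc, hF1⟩, hFN, hFNab, hFNbc, hFL, hFk, hFkb, hFkc⟩ := hF
  obtain ⟨⟨hw0, hwab, hwac, hwbc, hw1⟩, hwN, hwNab, hwNbc, hwL, hwk, hwkb, hwkc⟩ := hw
  have hp : 0 ≤ 1 - q := by linarith
  have hr : 0 ≤ 2 - q := by linarith
  rw [pairH_imgA_sepBiv2]
  positivity

/-! ### Identity and sign on the `b`-images -/

/-- **KEY IDENTITY B.**  On `b`-images the functional is `(1−q)²` times an explicit non-negative combination of products
(valid form of `G`) × (valid form of `w`) with `q`-factors in `{1, q(2−q), (1−q)(2−q), 1−q, q(1−q)(2−q), 2−q}`. [folklore] -/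
theorem pairH_imgB_sepBiv2 (q : ℝ) (G w : V5) :
    pairH q (imgB q G w) (sepBiv2 q) =
      (1 - q) ^ 2 * (
        masterN q (swapAB w) * (G.z0 ^ 2 + G.z0 * G.zac + G.z0 * G.zbc + G.zac * G.zbc)
        + q * (2 - q) * (G.zab * G.zac * (w.z0 * w.zab + w.zab * w.zac) + G.zac * G.zbc * kap (swapBC w)
            + G.zac * G.z1 * (w.z0 * w.zab + w.zab * w.zac) + masterN q G * (w.zab * w.zbc + lam w) + lam G * kap (swapBC w))
        + (1 - q) * (2 - q) * (G.zac ^ 2 * (w.zab * w.zbc + lam w) + G.zac * G.zbc * (w.zab * w.zbc + lam w)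
            + G.zac * G.z1 * kap (swapBC w) + kap (swapBC G) * kap (swapAB w))
        + masterN q G * masterN q (swapBC w)
        + masterN q (swapBC G) * (w.z0 ^ 2 + w.z0 * w.zab + w.z0 * w.zbc + w.zab * w.zbc + masterN q (swapAB w) + kap w)
        + (1 - q) * (masterN q (swapBC G) * kap (swapAB w))
        + q * (1 - q) * (2 - q) * (kap G * (w.zab * w.zbc + lam w))
        + (2 - q) * (kap (swapBC G) * masterN q (swapAB w))) := by
  simp only [pairH, sepBiv2, imgB, fanComboB, wedgeH, conv, edgeAC, edgeBC, detach, hx, hy, hz, V5.total, masterN, lam, kap, swapAB,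
    swapBC]
  ring

/-- **`sepBiv2 q` is non-negative on every `b`-image with valid legs** (`0 ≤ q ≤ 1`). [folklore] -/
theorem pairH_imgB_sepBiv2_nonneg {q : ℝ} (hq0 : 0 ≤ q) (hq1 : q ≤ 1) {G w : V5} (hG : Valid q G) (hw : Valid q w) :
    0 ≤ pairH q (imgB q G w) (sepBiv2 q) := by
  obtain ⟨⟨hG0, hGab, hGac, hGbc, hG1⟩, hGN, hGNab, hGNbc, hGL, hGk, hGkb, hGkc⟩ := hG
  obtain ⟨⟨hw0, hwab, hwac, hwbc, hw1⟩, hwN, hwNab, hwNbc, hwL, hwk, hwkb, hwkc⟩ := hw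
  have hp : 0 ≤ 1 - q := by linarith
  have hr : 0 ≤ 2 - q := by linarith
  rw [pairH_imgB_sepBiv2]
  positivity

/-- **`sepBiv2 q ∈ TSDualS q`**: the functional lies in the dual of the two-sided relaxation cone (`0 ≤ q ≤ 1`). [folklore] -/
theorem sepBiv2_tsDualS {q : ℝ} (hq0 : 0 ≤ q) (hq1 : q ≤ 1) : TSDualS q (sepBiv2 q) :=
  ⟨fun _ _ hF hw => pairH_imgA_sepBiv2_nonneg hq0 hq1 hF.valid hw.valid,
   fun _ _ hG hw => pairH_imgB_sepBiv2_nonneg hq0 hq1 hG.valid hw.valid⟩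

/-- **`sepBiv2 q ∈ OSDual q`**: the functional lies in the dual of the two-sided `InKE`-cone of `…OneSidedDominance` (`0 ≤ q ≤ 1`). [folklore] -/
theorem sepBiv2_osDual {q : ℝ} (hq0 : 0 ≤ q) (hq1 : q ≤ 1) : OSDual q (sepBiv2 q) :=
  ⟨fun _ _ hF hw => pairH_imgA_sepBiv2_nonneg hq0 hq1 (hF.valid hq0 hq1) (hw.valid hq0 hq1),
   fun _ _ hG hw => pairH_imgB_sepBiv2_nonneg hq0 hq1 (hG.valid hq0 hq1) (hw.valid hq0 hq1)⟩

/-! ### The witness: rest `BC_{1/10}`, rim step `E_{1/2}`, then both spokes `A_{9/10}`, `B_{7/10}` -/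

/-- The `b`-gadget of the witness: rim step `1/2` then `b`-spoke `7/10`, `G₀ = (3/20, 0, 3/20, 7/20, 7/20)`. [folklore] -/
def witG : V5 := ⟨3 / 20, 0, 3 / 20, 7 / 20, 7 / 20⟩

/-- The `a`-gadget of the witness: rim step `1/2` then `a`-spoke `9/10`, `F₀ = (1/20, 0, 1/20, 9/20, 9/20)`. [folklore] -/
def witF2 : V5 := ⟨1 / 20, 0, 1 / 20, 9 / 20, 9 / 20⟩

/-- The rest of the witness: one light `b`-spoke, `w₀ = BC_{1/10} = (9/10, 0, 0, 1/10, 0)`. [folklore] -/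
def witW2 : V5 := ⟨9 / 10, 0, 0, 1 / 10, 0⟩

/-- `witG = BC_{7/10} ∗ (rimStep q (1/2) fanInit)` (a genuine `b`-fan vector). [folklore] -/
theorem witG_eq (q : ℝ) : witG = conv (edgeBC (7 / 10)) (rimStep q (1 / 2) fanInit) := by
  rw [fanInit_eq]; ext <;> norm_num [witG, rimStep, conv, edgeBC, V5.total]

/-- `witF2 = BC_{9/10} ∗ (rimStep q (1/2) fanInit)` (a genuine `a`-fan vector). [folklore] -/
theorem witF2_eq (q : ℝ) : witF2 = conv (edgeBC (9 / 10)) (rimStep q (1 / 2) fanInit) := by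
  rw [fanInit_eq]; ext <;> norm_num [witF2, rimStep, conv, edgeBC, V5.total]

/-- `witW2 = edgeBC (1/10)`. [folklore] -/
theorem witW2_eq : witW2 = edgeBC (1 / 10) := by
  ext <;> norm_num [witW2, edgeBC]

/-- `witG ∈ InKE q`. [folklore] -/
theorem witG_inKE (q : ℝ) : InKE q witG := by
  rw [witG_eq q]
  exact InKE.step (IsLetter.bc (by norm_num) (by norm_num)) (InKE.rim (by norm_num) (by norm_num) (fanInit_inKE q))

/-- `witF2 ∈ InKE q`. [folklore] -/
theorem witF2_inKE (q : ℝ) : InKE q witF2 := by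
  rw [witF2_eq q]
  exact InKE.step (IsLetter.bc (by norm_num) (by norm_num)) (InKE.rim (by norm_num) (by norm_num) (fanInit_inKE q))

/-- `witW2 ∈ InKE q`. [folklore] -/
theorem witW2_inKE (q : ℝ) : InKE q witW2 := by
  have h : InKE q (conv (edgeBC (1 / 10)) delta0) := InKE.step (IsLetter.bc (by norm_num) (by norm_num)) InKE.base
  have e : conv (edgeBC (1 / 10)) delta0 = witW2 := by
    ext <;> norm_num [conv, edgeBC, delta0, witW2, V5.total]
  rwa [e] at h

/-- **The `HypAS` witness pairing in closed form**:
`⟪∧²AC_{9/10}(imgB q G₀ w₀), sepBiv2 q⟫ = (1−q)²(−159/200000 + 1809q/2000000 − 729q²/4000000)`. [folklore] -/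
theorem pairH_witnessA2 (q : ℝ) :
    pairH q (opAC (9 / 10) (imgB q witG witW2)) (sepBiv2 q) =
      (1 - q) ^ 2 * (-159 / 200000 + 1809 / 2000000 * q - 729 / 4000000 * q ^ 2) := by
  simp only [pairH, sepBiv2, opAC, Biv.lin3, Biv.add, Biv.smul, opTa, opWa, imgB, fanComboB, wedgeH, conv, edgeAC, edgeBC, detach, hx,
    hy, hz, V5.total, witG, witW2]
  ring

/-- **The `HypBS` witness pairing in closed form** (the same vector: `A_{9/10}` and `B_{7/10}` commute):
`⟪∧²BC_{7/10}(imgA q F₀ w₀), sepBiv2 q⟫ = (1−q)²(−159/200000 + 1809q/2000000 − 729q²/4000000)`. [folklore] -/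
theorem pairH_witnessB2 (q : ℝ) :
    pairH q (opBC (7 / 10) (imgA q witF2 witW2)) (sepBiv2 q) =
      (1 - q) ^ 2 * (-159 / 200000 + 1809 / 2000000 * q - 729 / 4000000 * q ^ 2) := by
  simp only [pairH, sepBiv2, opBC, Biv.lin3, Biv.add, Biv.smul, opTb, opWb, imgA, fanCombo, wedgeH, conv, edgeAC, detach, hx, hy, hz,
    V5.total, witF2, witW2]
  ring

/-- The witness polynomial is negative for `q ≤ 1` (`4·10⁶·P(q) = −291 − (1−q)(2889 − 729q)`). [folklore] -/
theorem witness2_poly_neg {q : ℝ} (hq1 : q ≤ 1) : -159 / 200000 + 1809 / 2000000 * q - 729 / 4000000 * q ^ 2 < (0 : ℝ) := by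
  have h1 : 0 ≤ 1 - q := sub_nonneg.2 hq1
  have h2 : (0 : ℝ) ≤ 2889 - 729 * q := by linarith
  nlinarith [mul_nonneg h1 h2]

/-- **The `HypAS` witness pairing is negative** for `q < 1`. [folklore] -/
theorem pairH_witnessA2_neg {q : ℝ} (hq1 : q < 1) : pairH q (opAC (9 / 10) (imgB q witG witW2)) (sepBiv2 q) < 0 := by
  rw [pairH_witnessA2]
  have h1 : 0 < (1 - q) ^ 2 := by have : 0 < 1 - q := sub_pos.2 hq1; positivity
  exact mul_neg_of_pos_of_neg h1 (witness2_poly_neg hq1.le)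

/-- **The `HypBS` witness pairing is negative** for `q < 1`. [folklore] -/
theorem pairH_witnessB2_neg {q : ℝ} (hq1 : q < 1) : pairH q (opBC (7 / 10) (imgA q witF2 witW2)) (sepBiv2 q) < 0 := by
  rw [pairH_witnessB2]
  have h1 : 0 < (1 - q) ^ 2 := by have : 0 < 1 - q := sub_pos.2 hq1; positivity
  exact mul_neg_of_pos_of_neg h1 (witness2_poly_neg hq1.le)

/-! ### The refutations -/

/-- **`HypAS q` is false** for every `0 < q < 1`: the `a`-spoke image of the `b`-fan image `imgB q G₀ w₀` lies outside `tsConeS q`. [folklore] -/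
theorem not_hypAS {q : ℝ} (hq0 : 0 < q) (hq1 : q < 1) : ¬ HypAS q := by
  intro hA
  have hG : InS q witG := (witG_inKE q).inS hq0 hq1.le
  have hw : InS q witW2 := (witW2_inKE q).inS hq0 hq1.le
  have h := hA witG witW2 (9 / 10) hG hw (by norm_num) (by norm_num) (sepBiv2 q) (sepBiv2_tsDualS hq0.le hq1.le)
  exact absurd h (not_le.2 (pairH_witnessA2_neg hq1))

/-- **`HypBS q` is false** for every `0 < q < 1`: the `b`-spoke image of the `a`-fan image `imgA q F₀ w₀` lies outside `tsConeS q`. [folklore] -/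
theorem not_hypBS {q : ℝ} (hq0 : 0 < q) (hq1 : q < 1) : ¬ HypBS q := by
  intro hB
  have hF : InS q witF2 := (witF2_inKE q).inS hq0 hq1.le
  have hw : InS q witW2 := (witW2_inKE q).inS hq0 hq1.le
  have h := hB witF2 witW2 (7 / 10) hF hw (by norm_num) (by norm_num) (sepBiv2 q) (sepBiv2_tsDualS hq0.le hq1.le)
  exact absurd h (not_le.2 (pairH_witnessB2_neg hq1))

/-- **`HypA q` is false** for every `0 < q < 1` (the `InKE`-cone `osCone q` of `…OneSidedDominance` a fortiori misses the witness). [folklore] -/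
theorem not_hypA {q : ℝ} (hq0 : 0 < q) (hq1 : q < 1) : ¬ HypA q := by
  intro hA
  have h := hA witG witW2 (9 / 10) (witG_inKE q) (witW2_inKE q) (by norm_num) (by norm_num) (sepBiv2 q) (sepBiv2_osDual hq0.le hq1.le)
  exact absurd h (not_le.2 (pairH_witnessA2_neg hq1))

/-- **`HypB q` is false** for every `0 < q < 1`. [folklore] -/
theorem not_hypB {q : ℝ} (hq0 : 0 < q) (hq1 : q < 1) : ¬ HypB q := by
  intro hB
  have h := hB witF2 witW2 (7 / 10) (witF2_inKE q) (witW2_inKE q) (by norm_num) (by norm_num) (sepBiv2 q) (sepBiv2_osDual hq0.le hq1.le)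
  exact absurd h (not_le.2 (pairH_witnessB2_neg hq1))

/-- **The witness image is not in the two-sided relaxation cone**: `∧²AC_{9/10}(imgB q G₀ w₀) ∉ tsConeS q` (`0 ≤ q < 1`). [folklore] -/
theorem witness2_not_mem_tsConeS {q : ℝ} (hq0 : 0 ≤ q) (hq1 : q < 1) : opAC (9 / 10) (imgB q witG witW2) ∉ tsConeS q :=
  fun h => absurd (h (sepBiv2 q) (sepBiv2_tsDualS hq0 hq1.le)) (not_le.2 (pairH_witnessA2_neg hq1))

/-- **The witness image is not in the two-sided `InKE`-cone**: `∧²AC_{9/10}(imgB q G₀ w₀) ∉ osCone q` (`0 ≤ q < 1`). [folklore] -/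
theorem witness2_not_mem_osCone {q : ℝ} (hq0 : 0 ≤ q) (hq1 : q < 1) : opAC (9 / 10) (imgB q witG witW2) ∉ osCone q :=
  fun h => absurd (h (sepBiv2 q) (sepBiv2_osDual hq0 hq1.le)) (not_le.2 (pairH_witnessA2_neg hq1))

/-! ### Appendix (gen 42, second landing): the functional in partition-mass minors -/

/-- **The separating functional as a combination of `2 × 2` minors of the pinned pair.**  For any two mass vectors `X` (pinned edge deleted) and
`Y` (pinned edge contracted), with `D(P,Q) := X_P Y_Q − X_Q Y_P` over the partitions `P, Q ∈ {0̂, ab, ac, bc, 1̂}` of the three apices: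
`⟪X ∧ Y, sepBiv2 q⟫ = (1−q)²·[ D(0̂,ab) + D(0̂,bc) + D(0̂,1̂) + D(ab,1̂) + D(ac,bc) − (1−q)·D(ab,ac) ]`.
So the two-sided dominance cones are refuted by a likelihood-ratio-type inequality between the deleted and the contracted state of the pinned
`a`-spoke that holds after every single fan but fails after "rim step, then both spokes". [folklore] -/
theorem pairH_wedgeH_sepBiv2 (q : ℝ) (X Y : V5) :
    pairH q (wedgeH X Y) (sepBiv2 q) =
      (1 - q) ^ 2 * ((X.z0 * Y.zab - X.zab * Y.z0) + (X.z0 * Y.zbc - X.zbc * Y.z0) + (X.z0 * Y.z1 - X.z1 * Y.z0)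
        + (X.zab * Y.z1 - X.z1 * Y.zab) + (X.zac * Y.zbc - X.zbc * Y.zac) - (1 - q) * (X.zab * Y.zac - X.zac * Y.zab)) := by
  simp only [pairH, sepBiv2, wedgeH, hx, hy, hz, V5.total]
  ring

/-- **No letter-stable cone is sandwiched between the single-fan images and their dual** (`0 < q < 1`): a set `K ⊆ tsConeS q` that is closed
under the letter operators (`IsLetterCone q K`) cannot contain all `b`-fan images over `InKE` — already the single witness image
`imgB q G₀ w₀` forces `∧²AC_{9/10}` of it into `K`, which `sepBiv2 q` excludes.  The same holds with `imgA q F₀ w₀` and the `b`-spoke. [folklore] -/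
theorem no_letterCone_between {q : ℝ} (hq0 : 0 ≤ q) (hq1 : q < 1) {K : Set Biv} (hK : IsLetterCone q K) (hsub : K ⊆ tsConeS q) :
    imgB q witG witW2 ∉ K :=
  fun h => witness2_not_mem_tsConeS hq0 hq1 (hsub (hK.ac (9 / 10) _ (by norm_num) (by norm_num) h))

/-- In particular **`tsConeS q` itself is not a letter cone** for `0 < q < 1` (it contains every `b`-fan image over `InS ⊇ InKE`). [folklore] -/
theorem not_isLetterCone_tsConeS {q : ℝ} (hq0 : 0 < q) (hq1 : q < 1) : ¬ IsLetterCone q (tsConeS q) :=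
  fun hK => no_letterCone_between hq0.le hq1 hK (fun _ hβ => hβ)
    (imgB_mem_tsConeS ((witG_inKE q).inS hq0 hq1.le) ((witW2_inKE q).inS hq0 hq1.le))

/-- And **`osCone q` (the two-sided `InKE`-cone of `…OneSidedDominance`) is not a letter cone** for `0 < q < 1`. [folklore] -/
theorem not_isLetterCone_osCone {q : ℝ} (hq0 : 0 < q) (hq1 : q < 1) : ¬ IsLetterCone q (osCone q) :=
  fun hK => witness2_not_mem_osCone hq0.le hq1 (hK.ac (9 / 10) _ (by norm_num) (by norm_num) (imgB_mem_osCone (witG_inKE q) (witW2_inKE q)))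

end ThreeApex

end FK

end Summit.CriticalPhenomena.PercolationContinuityZ3.Theorems
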